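import Summits.HodgeConjecture.HodgeConjecture.Theorems.F0P6aTwistDataCoprime                  -- ★ p849752∕p849780 (LA7-p02 (g3)): (S6) heads, split-prime rows (a)–(e), `exists_twistData_coprime`
import Summits.HodgeConjecture.HodgeConjecture.Theorems.F0P6aCanonicalTwistIdealArithRows       -- ★ p849355 (LA4-p04 (g2)): the six arithmetic rows of `(𝔞_can, p^f)` (HEAD-σ)
import Summits.HodgeConjecture.HodgeConjecture.Theorems.F0P6aCanonicalTwistIdealConjCoprime     -- ★ p849756 (LA4-p04 (g2)): row (d) of `𝔞_can` under `m_unmixed` (σ-form)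
import HarnessLib

/-!
# Crux `HLiu418` — P6 sub-line **F0-P6a**, (S6) ZIP: the twist data OF THE KOTTWITZ ROWS — the seven arithmetic rows of `RecordESheetReading` + row (d),
# with the Shimura–Taniyama datum `(𝔞_can(m₁, τR₁, w), p^f)` on the Frobenius readings, in ONE call from the P-line currency

Cell `hodgecm-mathlib` (D-0151), crux `stmt-HodgeConjecture-24832` (hLiu418), `--supports … --as helper` (count-neutral).  Integration of the (S6) heads
★ `F0P6aTwistData.exists_twistData_letterRows` (LA7-p02 (g3)) with the (S7)-side rows ★ `F0P6aCanonicalTwistIdealArithRows.canonicalTwistIdeal_eLetterRows_sigma`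
and ★ `F0P6aCanonicalTwistIdealConjCoprime.canonicalTwistIdeal_sup_complexConj_smul_eq_top_sigma` (LA4-p04 (g2)): the closer (S8) of `stub_ESHEET` gets
the arithmetic half of the letter by ONE call whose hypotheses are (i) the KOTTWITZ ROWS of the signature `m₁ := M ∘ (σ₁ ∘ ·)` in P-line currency
(`hpair`, `hcount`, `hbanal`, `hunmixed` = `kottRowsE` ∕ `kottRowsE_unmixed`), the arithmetic of `w` (`c•w ≠ w`, `p` prime, `p ∈ 𝔭_w`, `N𝔭_{c•w} = p^f`,
`p ∤ N`), (ii) an admissibility predicate `Adm γ 𝔞 n` (the class condition of the geometric rows, (S3)∕(S4)) met by `(𝔞_can, p^f)` at every Frobenius reading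
of the sheet `e` (`h₀adm`, the Frobenius pin (S7)∕(b2♯)) and by SOME datum with rows (a)(b)(c)(d) at every `γ` (`hgen` — ★ `F0P6aTwistDataCoprime` §1–§2 give
it as a split-prime type product once the class is read).  THEOREMS ONLY; no `Cruxes/…/Lines` import (`M` abstract for `mOf ι₁ Φ`).

MAIN STATEMENT `exists_twistData_letterRows_of_kottRows`: conclusion = `∃ twistIdeal twistNorm`, rows (a)(b)(c)(FROB-𝔞)(FROB-n)(π1)(FROB-can) of the
letter TOKEN FOR TOKEN (with `𝔞_can` spelled as the filtered product at `(σ₁, τR₁)` inside (FROB-can)՚s universally quantified RHS via ★ `canonicalTwistIdeal_indep`),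
PLUS (d) `twistIdeal γ ⊔ c • twistIdeal γ = ⊤` and `Adm γ (twistIdeal γ) (twistNorm γ)` for every `γ`.
HONEST LABEL.  HC_CM is proved only modulo the 7 printed citations (2 remaining named inputs: hLiu418 = stmt-HodgeConjecture-24832, h413 =
stmt-HodgeConjecture-24833) until rung 0 closes; nothing here changes a count.
[cite: Shimura1998, §13.1 Thm. 1 pp. 97–99 and (7); §18.6 Thm. 18.6 pp. 124–125] [cite: RapoportSmithlingZhang2020Diagonal, §4.1 (4.6) p. 16; §4.3 (4.23) p. 21]
-/

set_option autoImplicit false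
set_option linter.dupNamespace false  -- `Summit.HodgeConjecture.HodgeConjecture.…` BY DESIGN (D-0017)

noncomputable section

open NumberField IsDedekindDomain IsLocalRing
open scoped Pointwise nonZeroDivisors
open Literature.NumberTheory.GaloisRepresentations (closureValuationSubring IsAbsArithFrob)
open Summit.HodgeConjecture.HodgeConjecture.Theorems.F0P6aTwistData
open Summit.HodgeConjecture.HodgeConjecture.Theorems.F0P6aCanonicalTwistIdealArithRows (canonicalTwistIdeal_eLetterRows_sigma)
open Summit.HodgeConjecture.HodgeConjecture.Theorems.F0P6aCanonicalTwistIdealConjCoprime (canonicalTwistIdeal_sup_complexConj_smul_eq_top_sigma)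

namespace Summit.HodgeConjecture.HodgeConjecture.Theorems.F0P6aTwistDataOfKottRows

variable {F : Type} [Field F] [NumberField F] [IsCMField F] (w : HeightOneSpectrum (𝓞 F))
  {Fi : Type} [Field Fi] [Algebra F Fi] (e : Fi →ₐ[F] AlgebraicClosure (w.adicCompletion F))
  {L : Type} [Field L] (ι₁ : F →+* L) (M : (F →+* L) → ℕ)
  (σ₁ : AlgebraicClosure (w.adicCompletion F) →+* L)
  (hσ₁ : σ₁.comp (algebraMap F (AlgebraicClosure (w.adicCompletion F))) = ι₁)
  (τR₁ : (F →+* AlgebraicClosure (w.adicCompletion F)) → (𝓞 F →+* ↥(closureValuationSubring (w.adicCompletion F))))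
  (hτR₁ : ∀ (τ : F →+* AlgebraicClosure (w.adicCompletion F)) (x : 𝓞 F),
    ((τR₁ τ x : ↥(closureValuationSubring (w.adicCompletion F))) : AlgebraicClosure (w.adicCompletion F)) = τ (x : F))
  (hpair : ∀ τ : F →+* AlgebraicClosure (w.adicCompletion F),
    M (σ₁.comp τ) + M (σ₁.comp (τ.comp ((IsCMField.complexConj F : F ≃ₐ[↥(maximalRealSubfield F)] F) : F →+* F))) = 2)
  (hcount : ∑ τ ∈ (Finset.univ.filter fun τ : F →+* AlgebraicClosure (w.adicCompletion F) =>
      RingHom.ker ((residue ↥(closureValuationSubring (w.adicCompletion F))).comp (τR₁ τ)) =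
        (((IsCMField.complexConj F) • w).asIdeal : Ideal (𝓞 F))), M (σ₁.comp τ) = 1)
  (hbanal : ∀ τ : F →+* AlgebraicClosure (w.adicCompletion F),
    RingHom.ker ((residue ↥(closureValuationSubring (w.adicCompletion F))).comp (τR₁ τ)) ≠ (w.asIdeal : Ideal (𝓞 F)) →
    RingHom.ker ((residue ↥(closureValuationSubring (w.adicCompletion F))).comp (τR₁ τ)) ≠
      (((IsCMField.complexConj F) • w).asIdeal : Ideal (𝓞 F)) →
    M (σ₁.comp τ) = 0 ∨ M (σ₁.comp τ) = 2)
  (hunmixed : ∀ τ τ' : F →+* AlgebraicClosure (w.adicCompletion F),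
    RingHom.ker ((residue ↥(closureValuationSubring (w.adicCompletion F))).comp (τR₁ τ)) =
      RingHom.ker ((residue ↥(closureValuationSubring (w.adicCompletion F))).comp (τR₁ τ')) →
    RingHom.ker ((residue ↥(closureValuationSubring (w.adicCompletion F))).comp (τR₁ τ)) ≠ w.asIdeal →
    RingHom.ker ((residue ↥(closureValuationSubring (w.adicCompletion F))).comp (τR₁ τ)) ≠
      ((IsCMField.complexConj F) • w).asIdeal →
    M (σ₁.comp τ) = M (σ₁.comp τ'))

include hσ₁ hτR₁ hpair hcount hbanal hunmixed in
/-- **(S6) ZIP — THE TWIST DATA FROM THE KOTTWITZ ROWS.**  Under the Kottwitz rows of `m₁ := M ∘ (σ₁ ∘ ·)` (`hpair`, `hcount`, `hbanal`, `hunmixed`), the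
arithmetic of `w` and the level guard `p ∤ N`: given an admissibility `Adm` met by the Shimura–Taniyama datum `(𝔞_can(m₁, τR₁, w), p^f)` at every Frobenius
reading of the sheet `e` and by some datum with rows (a)(b)(c)(d) at every `γ`, there are `twistIdeal`, `twistNorm` with the SEVEN ARITHMETIC ROWS of
`RecordESheetReading` (a)(b)(c)(FROB-𝔞)(FROB-n)(π1)(FROB-can) token for token, row (d) (coprime to the conjugate) and admissibility everywhere — one call of ★
`exists_twistData_letterRows` on the six ★ rows of ★ `canonicalTwistIdeal_eLetterRows_sigma` and ★ `canonicalTwistIdeal_sup_complexConj_smul_eq_top_sigma`.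
[cite: Shimura1998, §13.1 Thm. 1 pp. 97–99 and (7); §18.6 Thm. 18.6 pp. 124–125] [cite: RapoportSmithlingZhang2020Diagonal, §4.1 (4.6) p. 16; §4.3 (4.23) p. 21] -/
theorem exists_twistData_letterRows_of_kottRows [IsGalois ℚ F] (hw : (IsCMField.complexConj F) • w ≠ w)
    {p f : ℕ} (hp : p.Prime) (hpw : (p : 𝓞 F) ∈ w.asIdeal) (hf : Nat.card (𝓞 F ⧸ ((IsCMField.complexConj F) • w).asIdeal) = p ^ f)
    {N : ℕ} (hN : ¬ p ∣ N)
    (Adm : (Fi ≃ₐ[F] Fi) → Ideal (𝓞 F) → ℕ → Prop)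
    (h₀adm : ∀ (σ : Field.absoluteGaloisGroup (w.adicCompletion F)), IsAbsArithFrob σ → ∀ γ : Fi ≃ₐ[F] Fi,
      ((AlgEquiv.restrictScalars F (Field.absoluteGaloisGroup.toAlgEquiv (w.adicCompletion F) σ) :
          AlgebraicClosure (w.adicCompletion F) ≃ₐ[F] AlgebraicClosure (w.adicCompletion F)) :
          AlgebraicClosure (w.adicCompletion F) →ₐ[F] AlgebraicClosure (w.adicCompletion F)).comp e = e.comp (γ : Fi →ₐ[F] Fi) →
      Adm γ (∏ τ ∈ Finset.univ.filter (fun τ : F →+* AlgebraicClosure (w.adicCompletion F) =>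
            M (σ₁.comp τ) ≠ 0 ∧ RingHom.ker ((residue ↥(closureValuationSubring (w.adicCompletion F))).comp (τR₁ τ)) ≠
              (((IsCMField.complexConj F) • w).asIdeal : Ideal (𝓞 F))),
          RingHom.ker ((residue ↥(closureValuationSubring (w.adicCompletion F))).comp (τR₁ τ))) (p ^ f))
    (hgen : ∀ γ : Fi ≃ₐ[F] Fi, ∃ (𝔞 : Ideal (𝓞 F)) (n : ℕ), Adm γ 𝔞 n ∧
      Ideal.span {((n : ℕ) : 𝓞 F)} = 𝔞 * (IsCMField.complexConj F) • 𝔞 ∧ 𝔞 ⊔ Ideal.span {((N : ℕ) : 𝓞 F)} = ⊤ ∧ 𝔞 ≠ ⊥ ∧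
      𝔞 ⊔ (IsCMField.complexConj F) • 𝔞 = ⊤) :
    ∃ (twistIdeal : (Fi ≃ₐ[F] Fi) → Ideal (𝓞 F)) (twistNorm : (Fi ≃ₐ[F] Fi) → ℕ),
    (∀ γ : Fi ≃ₐ[F] Fi, Ideal.span {((twistNorm γ : ℕ) : 𝓞 F)} = twistIdeal γ * (IsCMField.complexConj F) • twistIdeal γ) ∧
    (∀ γ : Fi ≃ₐ[F] Fi, twistIdeal γ ⊔ Ideal.span {((N : ℕ) : 𝓞 F)} = ⊤) ∧
    (∀ γ : Fi ≃ₐ[F] Fi, twistIdeal γ ≠ ⊥) ∧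
    (∀ (σ : Field.absoluteGaloisGroup (w.adicCompletion F)), IsAbsArithFrob σ → ∀ γ : Fi ≃ₐ[F] Fi,
      ((AlgEquiv.restrictScalars F (Field.absoluteGaloisGroup.toAlgEquiv (w.adicCompletion F) σ) :
          AlgebraicClosure (w.adicCompletion F) ≃ₐ[F] AlgebraicClosure (w.adicCompletion F)) :
          AlgebraicClosure (w.adicCompletion F) →ₐ[F] AlgebraicClosure (w.adicCompletion F)).comp e = e.comp (γ : Fi →ₐ[F] Fi) →
      w.asIdeal ∣ twistIdeal γ) ∧
    (∀ (σ : Field.absoluteGaloisGroup (w.adicCompletion F)), IsAbsArithFrob σ → ∀ γ : Fi ≃ₐ[F] Fi,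
      ((AlgEquiv.restrictScalars F (Field.absoluteGaloisGroup.toAlgEquiv (w.adicCompletion F) σ) :
          AlgebraicClosure (w.adicCompletion F) ≃ₐ[F] AlgebraicClosure (w.adicCompletion F)) :
          AlgebraicClosure (w.adicCompletion F) →ₐ[F] AlgebraicClosure (w.adicCompletion F)).comp e = e.comp (γ : Fi →ₐ[F] Fi) →
      twistNorm γ = p ^ f) ∧
    (∀ (σ : Field.absoluteGaloisGroup (w.adicCompletion F)), IsAbsArithFrob σ → ∀ γ : Fi ≃ₐ[F] Fi,
      ((AlgEquiv.restrictScalars F (Field.absoluteGaloisGroup.toAlgEquiv (w.adicCompletion F) σ) :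
          AlgebraicClosure (w.adicCompletion F) ≃ₐ[F] AlgebraicClosure (w.adicCompletion F)) :
          AlgebraicClosure (w.adicCompletion F) →ₐ[F] AlgebraicClosure (w.adicCompletion F)).comp e = e.comp (γ : Fi →ₐ[F] Fi) →
      twistIdeal γ ⊔ (((IsCMField.complexConj F) • w).asIdeal : Ideal (𝓞 F)) = ⊤) ∧
    (∀ (σ₀ : AlgebraicClosure (w.adicCompletion F) →+* L), σ₀.comp (algebraMap F (AlgebraicClosure (w.adicCompletion F))) = ι₁ →
      ∀ (τR : (F →+* AlgebraicClosure (w.adicCompletion F)) → (𝓞 F →+* ↥(closureValuationSubring (w.adicCompletion F)))),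
        (∀ (τ : F →+* AlgebraicClosure (w.adicCompletion F)) (x : 𝓞 F),
          ((τR τ x : ↥(closureValuationSubring (w.adicCompletion F))) : AlgebraicClosure (w.adicCompletion F)) = τ (x : F)) →
      ∀ (σ : Field.absoluteGaloisGroup (w.adicCompletion F)), IsAbsArithFrob σ → ∀ γ : Fi ≃ₐ[F] Fi,
        ((AlgEquiv.restrictScalars F (Field.absoluteGaloisGroup.toAlgEquiv (w.adicCompletion F) σ) :
            AlgebraicClosure (w.adicCompletion F) ≃ₐ[F] AlgebraicClosure (w.adicCompletion F)) :
            AlgebraicClosure (w.adicCompletion F) →ₐ[F] AlgebraicClosure (w.adicCompletion F)).comp e = e.comp (γ : Fi →ₐ[F] Fi) →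
        twistIdeal γ = ∏ τ ∈ Finset.univ.filter (fun τ : F →+* AlgebraicClosure (w.adicCompletion F) =>
            M (σ₀.comp τ) ≠ 0 ∧ RingHom.ker ((residue ↥(closureValuationSubring (w.adicCompletion F))).comp (τR τ)) ≠
              (((IsCMField.complexConj F) • w).asIdeal : Ideal (𝓞 F))),
          RingHom.ker ((residue ↥(closureValuationSubring (w.adicCompletion F))).comp (τR τ))) ∧
    (∀ γ : Fi ≃ₐ[F] Fi, twistIdeal γ ⊔ (IsCMField.complexConj F) • twistIdeal γ = ⊤) ∧
    (∀ γ : Fi ≃ₐ[F] Fi, Adm γ (twistIdeal γ) (twistNorm γ)) := by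
  obtain ⟨⟨h₀a, h₀b, h₀c, h₀w, h₀π⟩, h₀can⟩ :=
    canonicalTwistIdeal_eLetterRows_sigma w ι₁ M σ₁ hσ₁ τR₁ hτR₁ hpair hcount hbanal hw hp hpw hf hN
  have h₀d := canonicalTwistIdeal_sup_complexConj_smul_eq_top_sigma w M σ₁ τR₁ hτR₁ hpair hbanal hunmixed
  obtain ⟨tI, tN, ha, hb, hc, hw', hn, hπ, hcan, hadm⟩ := exists_twistData_letterRows w e ι₁ M N p f _ h₀a h₀b h₀c h₀w h₀π h₀can
    (fun γ 𝔞 n => Adm γ 𝔞 n ∧ 𝔞 ⊔ (IsCMField.complexConj F) • 𝔞 = ⊤) (fun σ hσ γ hγ => ⟨h₀adm σ hσ γ hγ, h₀d⟩)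
    (fun γ => by
      obtain ⟨𝔞, n, hA, hA1, hA2, hA3, hA4⟩ := hgen γ
      exact ⟨𝔞, n, ⟨hA, hA4⟩, hA1, hA2, hA3⟩)
  exact ⟨tI, tN, ha, hb, hc, hw', hn, hπ, hcan, fun γ => (hadm γ).2, fun γ => (hadm γ).1⟩

end Summit.HodgeConjecture.HodgeConjecture.Theorems.F0P6aTwistDataOfKottRows

end
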